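import Summits.QuantumFields.YangMills.Theorems.FluctuationComparisonRegPrIntLOrganTangentOneLoopLettersOfHolomorphy
import HarnessLib

/-!
# Route `UnitScaleTilt`, crux stmt-QuantumFields-20520 `FluctuationComparisonRegPrIntL`, PATH-B organ (covariant organ of record, RULING №56),
# group (I-curv) ∕ SPEC v1.8 (xv) — **THE MIXED ROWS FROM FIRST-ORDER OSCILLATION LETTERS (CAUCHY ROAD, ENTRYWISE WITH PROFILES)**: the pointwise
# variation rows that ✓p828081 `Literature.Analysis.Matrix.TraceInvMulMixedDifference.abs_fourPt_trace_inv_mul_le_of_summedProfiles` (w4 g26) sums —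
# first differences `∝ s`, `∝ t` with ONE profile and the DOUBLE difference `∝ s·t` with a TWO-profile — supplied ENTRY BY ENTRY from separate
# holomorphy of `(σ,τ) ↦ K(σ,τ)_{ab}` on a bidisc plus FIRST-ORDER OSCILLATION majorants carrying the localisation profiles `d` (σ-move near bond
# `b`) and `d′` (τ-move near bond `b′`).  NO second-order response letter is used: the mixed row comes from the two first-order oscillation
# letters by the two-step Cauchy estimate of ✓p822180 (UV3-NODE §80 «CAUCHY ROAD: first derivative only», [Balaban1987RG1] (3.15)–(3.17) p.273 ∕
# (3.54) p.280), and `min(e^{−θd}, e^{−θd′}) ≤ e^{−(θ∕2)(d + d′)}` turns the pair of one-profile letters into a two-profile row at HALF rate.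

Cell `ym3-torus`, WIDTH COPY «width 19» of ★p1 (seat `ym3-torus-px19`, gen 23); `--supports stmt-QuantumFields-20520 --as helper`; count-neutral;
def-free.  Written on w4 g26's «px19: KNIT — welcome» (bus 16:37:49Z) with its docking text: target = the SUMMED-ROW rectangle ✓p828081 (rows
`hK1c0 hK1c1 hK1r0 hK2c1 hK2r0 hK12 hH1r hH2r hH12`), the pointwise ⟹ summed step being ✓p828513's `rowSum_le_of_profile_range` ∕
`colSum_le_of_profile_range` ∕ `sum_ball_abs_le_twoProfile` (response road, w4) — not re-done here.
INHABITATION (★★OWNER RULING №100): LAW-FREE — `Kc σ τ = K(ι∘Φ(σ,τ))` for the organ's one-loop operator `K_V` (or `H^O_V`) along ✓p828173's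
complex two-bond square; own analyticity; the oscillation-with-profile letters are the chart's localised first-order response ((190)-type).

WHAT THIS FILE PROVES (sorry-free; entries of `Kc : ℂ → ℂ → Matrix n n ℂ`, any index type `n`; real move sizes `0 ≤ s ≤ ρ∕4`, `0 ≤ t ≤ ρ′∕4`).
* §1 ★`abs_sub_le_of_osc_holo` — ONE MOVE, OSCILLATION FORM: `f : ℂ → ℂ` holomorphic on `ball 0 ρ` with oscillation `|f z − f z′| ≤ O` there ⟹
  `|f s − f 0| ≤ (4O∕ρ)·s` (✓`norm_sub_le_of_holo` applied to `f − f 0`).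
* §2 ★★`abs_doubleDiff_le_of_osc_holo_tau` ∕ `…_sigma` ∕ ★★`abs_doubleDiff_le_min_of_osc_holo` — THE SQUARE, OSCILLATION FORM: `g : ℂ → ℂ → ℂ`
  separately holomorphic on `ball 0 ρ × ball 0 ρ′`; τ-oscillation `≤ Oτ` uniformly over the σ-disc (resp. σ-oscillation `≤ Oσ` over the τ-disc) ⟹
  `|g s t − g s 0 − g 0 t + g 0 0| ≤ (8·Oτ∕(ρρ′))·s·t` (resp. `Oσ`; hence `min`) — ✓p822180 rescaled to physical sizes.
* §3 ★`min_exp_le_exp_half_add` (`min(B e^{−θd}, B e^{−θd′}) ≤ B·e^{−(θ∕2)(d+d′)}`); ★★★`entry_rows_of_osc_holo` — for a matrix family: from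
  (Hσ) σ-slices and (Hτ) τ-slices of every entry holomorphic, (Oσ) `|Kc σ τ a b − Kc σ′ τ a b| ≤ B·e^{−θ·d a}` over the bidisc, (Oτ) `… ≤ B·e^{−θ·d′ a}`:
  the three POINTWISE rows `|Kc s τ₀ a b − Kc 0 τ₀ a b| ≤ (4B∕ρ)·e^{−θ d a}·s` (`τ₀ ∈ {0, t}`), `|Kc σ₀ t a b − Kc σ₀ 0 a b| ≤ (4B∕ρ′)·e^{−θ d′ a}·t`
  (`σ₀ ∈ {0, s}`), `|ΔΔ Kc a b| ≤ (8B∕(ρρ′))·e^{−(θ∕2)(d a + d′ a)}·s·t` — the entrywise inputs of ✓p828513 §1 ∕ `sum_ball_abs_le_twoProfile` (with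
  the real corner matrices read off by the consumer).

WHAT THIS IS NOT: the summation to ✓p828081's rows (range `r`, ball count `V`, 1-Lipschitz profiles — ✓p828513, w4's road) and layer (2) (m-uniformity
of `B, ρ, θ`; [Balaban1984PropagatorsII] ∕ [Balaban1985BackgroundPropagators]) are not touched; nothing of Bałaban's operators is constructed; (xv)∕(I-curv)∕D0,
rows v0.1–v0.4 UNDISCHARGED; the five registered stubs, 20520, 19936, 19200, `YM3TorusSU2` NOT proved; no summit is proved by a helper.  R3 = SU(2) YM₃ on
T³ — NOT d = 4, NOT infinite volume, NOT a mass gap, NOT Clay; the Yang–Mills mass gap is NOT proved.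

References: T. Bałaban, CMP **109** (1987) 249–301 [Balaban1987RG1] ((3.15)–(3.17) p.273, (3.54) p.280); CMP **102** (1985) 277–309 [Balaban1985Variational]
(Prop. 9 (190) p.308–309).
-/

noncomputable section

open Metric Set
open Summit.QuantumFields.YangMills.Theorems.OrganTangentBidiscDoubleDifference (norm_doubleDiff_le_of_sep_holo norm_doubleDiff_le_of_sep_holo')
open Summit.QuantumFields.YangMills.Theorems.OrganTangentOneLoopLettersOfHolomorphy (rescale_margin mapsTo_mul_ball norm_sub_le_of_holo)

namespace Summit.QuantumFields.YangMills.Theorems.OrganTangentMixedRowsOfHolomorphy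

/-! ## §1 One move, oscillation form -/

/-- ★ **ONE MOVE FROM AN OSCILLATION LETTER**: `f` holomorphic on `ball 0 ρ` with `|f z − f z′| ≤ O` there ⟹ `|f s − f 0| ≤ (4O∕ρ)·s` for real
`0 ≤ s ≤ ρ∕4` (✓`norm_sub_le_of_holo` on `f − f 0`, whose modulus is `≤ O` on the disc). [cite: Balaban1987RG1, (3.15)-(3.17) p.273] -/
theorem abs_sub_le_of_osc_holo {f : ℂ → ℂ} {ρ O : ℝ} (hf : DifferentiableOn ℂ f (ball (0 : ℂ) ρ))
    (hO : ∀ z ∈ ball (0 : ℂ) ρ, ∀ z' ∈ ball (0 : ℂ) ρ, ‖f z - f z'‖ ≤ O) {s : ℝ} (hs0 : 0 ≤ s) (hsρ : s ≤ ρ / 4) :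
    ‖f (s : ℂ) - f 0‖ ≤ (4 * O / ρ) * s := by
  rcases hs0.eq_or_lt with rfl | hs
  · simp
  have hρ : 0 < ρ := by linarith
  have h0 : (0 : ℂ) ∈ ball (0 : ℂ) ρ := mem_ball_self hρ
  have hg : DifferentiableOn ℂ (fun z => f z - f 0) (ball (0 : ℂ) ρ) := hf.sub_const _
  have hgM : ∀ z ∈ ball (0 : ℂ) ρ, ‖f z - f 0‖ ≤ O := fun z hz => hO z hz 0 h0
  have h := norm_sub_le_of_holo hg hgM hs0 hsρ
  simpa using h

/-! ## §2 The square, oscillation forms -/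

/-- ★★ **THE DOUBLE DIFFERENCE FROM THE τ-OSCILLATION LETTER**: `g : ℂ → ℂ → ℂ`, σ-slices holomorphic on `ball 0 ρ` for `τ ∈ ball 0 ρ′`, τ-slices
holomorphic on `ball 0 ρ′` for `σ ∈ ball 0 ρ`, and `|g σ τ − g σ τ′| ≤ Oτ` for `σ ∈ ball 0 ρ`, `τ, τ′ ∈ ball 0 ρ′` ⟹
`|g s t − g s 0 − g 0 t + g 0 0| ≤ (8·Oτ∕(ρρ′))·s·t` for `0 ≤ s ≤ ρ∕4`, `0 ≤ t ≤ ρ′∕4`. [cite: Balaban1987RG1, (3.15)-(3.17) p.273 and (3.54) p.280] -/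
theorem abs_doubleDiff_le_of_osc_holo_tau {g : ℂ → ℂ → ℂ} {ρ ρ' Oτ : ℝ}
    (hσ : ∀ τ ∈ ball (0 : ℂ) ρ', DifferentiableOn ℂ (fun σ => g σ τ) (ball (0 : ℂ) ρ))
    (hτ : ∀ σ ∈ ball (0 : ℂ) ρ, DifferentiableOn ℂ (g σ) (ball (0 : ℂ) ρ'))
    (hOτ : ∀ σ ∈ ball (0 : ℂ) ρ, ∀ τ ∈ ball (0 : ℂ) ρ', ∀ τ' ∈ ball (0 : ℂ) ρ', ‖g σ τ - g σ τ'‖ ≤ Oτ)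
    {s t : ℝ} (hs0 : 0 ≤ s) (hsρ : s ≤ ρ / 4) (ht0 : 0 ≤ t) (htρ : t ≤ ρ' / 4) :
    ‖g (s : ℂ) (t : ℂ) - g (s : ℂ) 0 - g 0 (t : ℂ) + g 0 0‖ ≤ (8 * Oτ / (ρ * ρ')) * s * t := by
  rcases hs0.eq_or_lt with rfl | hs
  · simp
  rcases ht0.eq_or_lt with rfl | ht
  · simp
  have hρ : 0 < ρ := by linarith
  have hρ' : 0 < ρ' := by linarith
  have hO0 : 0 ≤ Oτ := (norm_nonneg _).trans (hOτ 0 (mem_ball_self hρ) 0 (mem_ball_self hρ') 0 (mem_ball_self hρ'))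
  obtain ⟨hr, hrR, hinv⟩ := rescale_margin hs hsρ
  obtain ⟨hr', hr'R', hinv'⟩ := rescale_margin ht htρ
  have hmaps := mapsTo_mul_ball (ρ := ρ) hs
  have hmaps' := mapsTo_mul_ball (ρ := ρ') ht
  have h0t : (0 : ℂ) * (t : ℂ) ∈ ball (0 : ℂ) ρ' := by rw [zero_mul]; exact mem_ball_self hρ'
  have h1t : (1 : ℂ) * (t : ℂ) ∈ ball (0 : ℂ) ρ' := by
    apply hmaps'; rw [mem_ball_zero_iff, norm_one]; linarith
  have hH0 : DifferentiableOn ℂ (fun σ : ℂ => g (σ * (s : ℂ)) ((0 : ℂ) * (t : ℂ))) (ball (0 : ℂ) (ρ / s)) :=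
    (hσ _ h0t).comp ((differentiableOn_id).mul_const _) hmaps
  have hH1 : DifferentiableOn ℂ (fun σ : ℂ => g (σ * (s : ℂ)) ((1 : ℂ) * (t : ℂ))) (ball (0 : ℂ) (ρ / s)) :=
    (hσ _ h1t).comp ((differentiableOn_id).mul_const _) hmaps
  have hHτ : ∀ σ ∈ ball (0 : ℂ) (ρ / s),
      DifferentiableOn ℂ (fun τ : ℂ => g (σ * (s : ℂ)) (τ * (t : ℂ))) (ball (0 : ℂ) (ρ' / t)) := fun σ hσ' =>
    (hτ _ (hmaps hσ')).comp ((differentiableOn_id).mul_const _) hmaps'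
  have hHM : ∀ σ ∈ ball (0 : ℂ) (ρ / s), ∀ τ ∈ ball (0 : ℂ) (ρ' / t), ∀ τ' ∈ ball (0 : ℂ) (ρ' / t),
      ‖g (σ * (s : ℂ)) (τ * (t : ℂ)) - g (σ * (s : ℂ)) (τ' * (t : ℂ))‖ ≤ Oτ := fun σ hσ' τ hτ' τ' hτ'' =>
    hOτ _ (hmaps hσ') _ (hmaps' hτ') _ (hmaps' hτ'')
  have h := norm_doubleDiff_le_of_sep_holo (H := fun σ τ : ℂ => g (σ * (s : ℂ)) (τ * (t : ℂ)))
    hr hrR hr' hr'R' hH0 hH1 hHτ hHM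
  simp only [one_mul, zero_mul] at h
  calc ‖g (s : ℂ) (t : ℂ) - g (s : ℂ) 0 - g 0 (t : ℂ) + g 0 0‖ ≤ 2 * Oτ / ((ρ / s - 2) * (ρ' / t - 2)) := h
    _ = 2 * Oτ * ((1 / (ρ / s - 2)) * (1 / (ρ' / t - 2))) := by rw [one_div_mul_one_div, mul_one_div]
    _ ≤ 2 * Oτ * ((2 * s / ρ) * (2 * t / ρ')) := by
        apply mul_le_mul_of_nonneg_left _ (by positivity)
        exact mul_le_mul hinv hinv' (by positivity) (by positivity)
    _ = (8 * Oτ / (ρ * ρ')) * s * t := by ring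

/-- ★★ The σ-oscillation version: `|g σ τ − g σ′ τ| ≤ Oσ` for `τ ∈ ball 0 ρ′`, `σ, σ′ ∈ ball 0 ρ` ⟹ the same double difference is
`≤ (8·Oσ∕(ρρ′))·s·t`. [cite: Balaban1987RG1, (3.15)-(3.17) p.273 and (3.54) p.280] -/
theorem abs_doubleDiff_le_of_osc_holo_sigma {g : ℂ → ℂ → ℂ} {ρ ρ' Oσ : ℝ}
    (hσ : ∀ τ ∈ ball (0 : ℂ) ρ', DifferentiableOn ℂ (fun σ => g σ τ) (ball (0 : ℂ) ρ))
    (hτ : ∀ σ ∈ ball (0 : ℂ) ρ, DifferentiableOn ℂ (g σ) (ball (0 : ℂ) ρ'))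
    (hOσ : ∀ τ ∈ ball (0 : ℂ) ρ', ∀ σ ∈ ball (0 : ℂ) ρ, ∀ σ' ∈ ball (0 : ℂ) ρ, ‖g σ τ - g σ' τ‖ ≤ Oσ)
    {s t : ℝ} (hs0 : 0 ≤ s) (hsρ : s ≤ ρ / 4) (ht0 : 0 ≤ t) (htρ : t ≤ ρ' / 4) :
    ‖g (s : ℂ) (t : ℂ) - g (s : ℂ) 0 - g 0 (t : ℂ) + g 0 0‖ ≤ (8 * Oσ / (ρ * ρ')) * s * t := by
  -- transpose the two variables and use the τ-version
  have h := abs_doubleDiff_le_of_osc_holo_tau (g := fun τ σ => g σ τ) (ρ := ρ') (ρ' := ρ) hτ hσ hOσ ht0 htρ hs0 hsρ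
  have heq : g (s : ℂ) (t : ℂ) - g 0 (t : ℂ) - g (s : ℂ) 0 + g 0 0 = g (s : ℂ) (t : ℂ) - g (s : ℂ) 0 - g 0 (t : ℂ) + g 0 0 := by ring
  rw [heq] at h
  calc ‖g (s : ℂ) (t : ℂ) - g (s : ℂ) 0 - g 0 (t : ℂ) + g 0 0‖ ≤ (8 * Oσ / (ρ' * ρ)) * t * s := h
    _ = (8 * Oσ / (ρ * ρ')) * s * t := by ring

/-- ★★ **BOTH OSCILLATION LETTERS ⟹ THE `min`** (the shape §3 turns into a two-profile row).
[cite: Balaban1987RG1, (3.15)-(3.17) p.273 and (3.54) p.280] -/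
theorem abs_doubleDiff_le_min_of_osc_holo {g : ℂ → ℂ → ℂ} {ρ ρ' Oσ Oτ : ℝ}
    (hσ : ∀ τ ∈ ball (0 : ℂ) ρ', DifferentiableOn ℂ (fun σ => g σ τ) (ball (0 : ℂ) ρ))
    (hτ : ∀ σ ∈ ball (0 : ℂ) ρ, DifferentiableOn ℂ (g σ) (ball (0 : ℂ) ρ'))
    (hOσ : ∀ τ ∈ ball (0 : ℂ) ρ', ∀ σ ∈ ball (0 : ℂ) ρ, ∀ σ' ∈ ball (0 : ℂ) ρ, ‖g σ τ - g σ' τ‖ ≤ Oσ)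
    (hOτ : ∀ σ ∈ ball (0 : ℂ) ρ, ∀ τ ∈ ball (0 : ℂ) ρ', ∀ τ' ∈ ball (0 : ℂ) ρ', ‖g σ τ - g σ τ'‖ ≤ Oτ)
    {s t : ℝ} (hs0 : 0 ≤ s) (hsρ : s ≤ ρ / 4) (ht0 : 0 ≤ t) (htρ : t ≤ ρ' / 4) :
    ‖g (s : ℂ) (t : ℂ) - g (s : ℂ) 0 - g 0 (t : ℂ) + g 0 0‖ ≤ (8 * min Oσ Oτ / (ρ * ρ')) * s * t := by
  rcases le_total Oσ Oτ with hle | hle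
  · rw [min_eq_left hle]; exact abs_doubleDiff_le_of_osc_holo_sigma hσ hτ hOσ hs0 hsρ ht0 htρ
  · rw [min_eq_right hle]; exact abs_doubleDiff_le_of_osc_holo_tau hσ hτ hOτ hs0 hsρ ht0 htρ

/-! ## §3 Entrywise rows with profiles -/

/-- ★ `min(B·e^{−θ·d}, B·e^{−θ·d′}) ≤ B·e^{−(θ∕2)·(d + d′)}` for `B ≥ 0`, `θ ≥ 0` (the smaller exponential is below the geometric mean).
[folklore] -/
theorem min_exp_le_exp_half_add {B θ : ℝ} (hB : 0 ≤ B) (hθ : 0 ≤ θ) (d d' : ℝ) :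
    min (B * Real.exp (-(θ * d))) (B * Real.exp (-(θ * d'))) ≤ B * Real.exp (-(θ / 2 * (d + d'))) := by
  rcases le_total d' d with h | h
  · -- `d` is the larger: the first term is the smaller
    calc min (B * Real.exp (-(θ * d))) (B * Real.exp (-(θ * d'))) ≤ B * Real.exp (-(θ * d)) := min_le_left _ _
      _ ≤ B * Real.exp (-(θ / 2 * (d + d'))) := by
          apply mul_le_mul_of_nonneg_left _ hB
          exact Real.exp_le_exp.2 (by nlinarith)
  · calc min (B * Real.exp (-(θ * d))) (B * Real.exp (-(θ * d'))) ≤ B * Real.exp (-(θ * d')) := min_le_right _ _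
      _ ≤ B * Real.exp (-(θ / 2 * (d + d'))) := by
          apply mul_le_mul_of_nonneg_left _ hB
          exact Real.exp_le_exp.2 (by nlinarith)

/-- ★★★ **THE THREE POINTWISE ROWS OF AN ENTRY FROM FIRST-ORDER OSCILLATION LETTERS.**  `Kc : ℂ → ℂ → Matrix n n ℂ` with, for the entry `(a,b)`:
σ-slices holomorphic on `ball 0 ρ` (for `τ ∈ ball 0 ρ′`), τ-slices holomorphic on `ball 0 ρ′` (for `σ ∈ ball 0 ρ`); σ-OSCILLATION `≤ B·e^{−θ·d a}`
uniformly over the τ-disc and τ-OSCILLATION `≤ B·e^{−θ·d′ a}` uniformly over the σ-disc (`B, θ ≥ 0`; `d, d′` the localisation profiles of the two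
one-bond moves).  THEN for `0 ≤ s ≤ ρ∕4`, `0 ≤ t ≤ ρ′∕4` and `σ₀ ∈ ball 0 ρ`, `τ₀ ∈ ball 0 ρ′`:
`|Kc s τ₀ a b − Kc 0 τ₀ a b| ≤ (4B∕ρ)·e^{−θ·d a}·s`, `|Kc σ₀ t a b − Kc σ₀ 0 a b| ≤ (4B∕ρ′)·e^{−θ·d′ a}·t`,
`|Kc s t a b − Kc s 0 a b − Kc 0 t a b + Kc 0 0 a b| ≤ (8B∕(ρρ′))·e^{−(θ∕2)(d a + d′ a)}·s·t`.
[cite: Balaban1987RG1, (3.15)-(3.17) p.273 and (3.54) p.280; Balaban1985Variational, Prop. 9 (190) p.308-309] -/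
theorem entry_rows_of_osc_holo {n : Type*} {Kc : ℂ → ℂ → Matrix n n ℂ} {ρ ρ' B θ : ℝ} (hB : 0 ≤ B) (hθ : 0 ≤ θ)
    {d d' : n → ℝ} (a b : n)
    (hσ : ∀ τ ∈ ball (0 : ℂ) ρ', DifferentiableOn ℂ (fun σ => Kc σ τ a b) (ball (0 : ℂ) ρ))
    (hτ : ∀ σ ∈ ball (0 : ℂ) ρ, DifferentiableOn ℂ (fun τ => Kc σ τ a b) (ball (0 : ℂ) ρ'))
    (hOσ : ∀ τ ∈ ball (0 : ℂ) ρ', ∀ σ ∈ ball (0 : ℂ) ρ, ∀ σ' ∈ ball (0 : ℂ) ρ,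
      ‖Kc σ τ a b - Kc σ' τ a b‖ ≤ B * Real.exp (-(θ * d a)))
    (hOτ : ∀ σ ∈ ball (0 : ℂ) ρ, ∀ τ ∈ ball (0 : ℂ) ρ', ∀ τ' ∈ ball (0 : ℂ) ρ',
      ‖Kc σ τ a b - Kc σ τ' a b‖ ≤ B * Real.exp (-(θ * d' a)))
    {s t : ℝ} (hs0 : 0 ≤ s) (hsρ : s ≤ ρ / 4) (ht0 : 0 ≤ t) (htρ : t ≤ ρ' / 4) :
    (∀ τ₀ ∈ ball (0 : ℂ) ρ', ‖Kc (s : ℂ) τ₀ a b - Kc 0 τ₀ a b‖ ≤ (4 * (B * Real.exp (-(θ * d a))) / ρ) * s) ∧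
    (∀ σ₀ ∈ ball (0 : ℂ) ρ, ‖Kc σ₀ (t : ℂ) a b - Kc σ₀ 0 a b‖ ≤ (4 * (B * Real.exp (-(θ * d' a))) / ρ') * t) ∧
    ‖Kc (s : ℂ) (t : ℂ) a b - Kc (s : ℂ) 0 a b - Kc 0 (t : ℂ) a b + Kc 0 0 a b‖ ≤
      (8 * (B * Real.exp (-(θ / 2 * (d a + d' a)))) / (ρ * ρ')) * s * t := by
  refine ⟨fun τ₀ hτ₀ => ?_, fun σ₀ hσ₀ => ?_, ?_⟩
  · exact abs_sub_le_of_osc_holo (hσ τ₀ hτ₀) (fun z hz z' hz' => hOσ τ₀ hτ₀ z hz z' hz') hs0 hsρ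
  · exact abs_sub_le_of_osc_holo (hτ σ₀ hσ₀) (fun z hz z' hz' => hOτ σ₀ hσ₀ z hz z' hz') ht0 htρ
  · rcases hs0.eq_or_lt with rfl | hs
    · simp
    rcases ht0.eq_or_lt with rfl | ht
    · simp
    have hρ : 0 < ρ := by linarith
    have hρ' : 0 < ρ' := by linarith
    have h := abs_doubleDiff_le_min_of_osc_holo (g := fun σ τ => Kc σ τ a b) hσ hτ hOσ hOτ hs0 hsρ ht0 htρ
    refine h.trans ?_
    have hmin := min_exp_le_exp_half_add hB hθ (d a) (d' a)
    have : 8 * min (B * Real.exp (-(θ * d a))) (B * Real.exp (-(θ * d' a))) / (ρ * ρ') ≤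
        8 * (B * Real.exp (-(θ / 2 * (d a + d' a)))) / (ρ * ρ') :=
      div_le_div_of_nonneg_right (by linarith [hmin]) (by positivity)
    exact mul_le_mul_of_nonneg_right (mul_le_mul_of_nonneg_right this hs0) ht0

end Summit.QuantumFields.YangMills.Theorems.OrganTangentMixedRowsOfHolomorphy
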